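import Summits.Ventures.CertifiedManyBodySolver.Downfold.EmeryBoxesTl1223OPJetWindowP1
import Summits.Ventures.CertifiedManyBodySolver.Downfold.EmeryBoxesTl1223OPJetWindowP2
import Summits.Ventures.CertifiedManyBodySolver.Downfold.EmeryBoxesTl1223OPJetWindowP3
import Summits.Ventures.CertifiedManyBodySolver.Downfold.EmeryBoxesTl1223OPJetWindowP4
import Summits.Ventures.CertifiedManyBodySolver.Downfold.EmeryBoxesTl1223OPJetWindowP5
import Summits.Ventures.CertifiedManyBodySolver.Downfold.EmeryFermiFillingLa214
import HarnessLib

/-!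
# THE WHOLE-BAND (OBJECT-M) ONE-BAND SET AS CERTIFIED WINDOWS — TlBa₂Ca₂Cu₃O₉ outer plane (Tl-1223 OP), ν = 0.42 — ASSEMBLED: `(t_J, t′_J/t_J, t″_J/t_J)` of the nodal 2-jet at ε_F
# for EVERY member of box #314's outer-plane σ companion `emeryBoxTl1223OPK11Src` (INFL-3to1-B §B.101)

Venture CertifiedManyBodySolver, cell `pub/hubbard-downfold` (stage S1; INFLATION-RULES-3to1-B §B.101), seat hubbard-downfold-mod-4 (technique B = band
level, g45); namespace `Summit.Ventures.CertifiedManyBodySolver.Downfold.Emery`. Everything PROVED (`decide +kernel` on the bisection certificates of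
`EmeryBandJetWindow.jetLeaf` — slope arithmetic `EmerySlopeArith(Sound)` — composed with the sub-box ε_F brackets of `EmeryFermiFillingTl1223OPSubs` and
`abFilling_fermiEnergyOf'`; generator HOME/hubbard-downfold-mod-4/jet-g45/gen/emit_boxes2.py, bit-exact python mirror of the kernel checker).
WHAT THIS IS NOT: a statement about TlBa₂Ca₂Cu₃O₉ outer plane (Tl-1223 OP) — the typed box (box #314's outer-plane σ companion `emeryBoxTl1223OPK11Src` (TlBa₂Ca₂Cu₃O₉ OUTER plane, (K) source rows)) is SCREENING-GRADE; `U = 0` one-body kinematics of the σ model; the ε_F coupling is per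
SUB-BOX (each member's jet is bounded over its sub-box's certified ε_F bracket, not at its own ε_F), so the windows are OUTER bounds of the true ranges.

| Δ_pd range | window |
|---|---|
| whole Δ_pd hull [1.47, 2.24] | t_J [0.3165, 0.5096] eV, t′_J/t_J [-0.1695, -0.0388], t″_J/t_J [0.0728, 0.2963] |

Sources: [HybertsenSchluterChristensen1989, Eq. (1)]; [AndersenEtAl1995, §6]; [PavariniEtAl2001, Eq. (1)]; interval/slope arithmetic [folklore].
-/

noncomputable section

namespace Summit.Ventures.CertifiedManyBodySolver.Downfold.Emery

open Real Set Literature.Analysis.ValidatedNumerics.Numerics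

/-- **TlBa₂Ca₂Cu₃O₉ outer plane (Tl-1223 OP), whole Δ_pd hull [1.47, 2.24], ν = 0.42** — for EVERY member θ = (Δ, t_pd, t_pp, t_pp′), with ε = ε_F(θ) and x₀ = xNode(ε_F): nodal-jet hopping
`t_J ∈ [0.3165, 0.5096]` eV, `t′_J/t_J ∈ [-0.1695, -0.0388]`, `t″_J/t_J ∈ [0.0728, 0.2963]` (union of the sub-box windows 0_0, 0_1, 1_0, 1_1, 2_0, 2_1, 3_0, 3_1). [folklore] -/
theorem tl1223OPBox_jetWindow_nu042 {Δ a b c : ℝ} (hΔ : Δ ∈ Icc (147 / 100 : ℝ) (56 / 25 : ℝ)) (ha : a ∈ Icc (117 / 100 : ℝ) (69 / 50 : ℝ))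
    (hb : b ∈ Icc (61 / 100 : ℝ) (73 / 100 : ℝ)) (hc : c ∈ Icc (7 / 50 : ℝ) (9 / 50 : ℝ)) :
    jetT Δ a b c (xNode Δ a b c (fermiEnergyOf Δ a b c (21 / 50 : ℝ))) (fermiEnergyOf Δ a b c (21 / 50 : ℝ)) ∈ Icc (633 / 2000 : ℝ) (637 / 1250 : ℝ) ∧
      jetTp Δ a b c (xNode Δ a b c (fermiEnergyOf Δ a b c (21 / 50 : ℝ))) (fermiEnergyOf Δ a b c (21 / 50 : ℝ)) / jetT Δ a b c (xNode Δ a b c (fermiEnergyOf Δ a b c (21 / 50 : ℝ))) (fermiEnergyOf Δ a b c (21 / 50 : ℝ)) ∈ Icc (-339 / 2000 : ℝ) (-97 / 2500 : ℝ) ∧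
      jetTpp Δ a b c (xNode Δ a b c (fermiEnergyOf Δ a b c (21 / 50 : ℝ))) (fermiEnergyOf Δ a b c (21 / 50 : ℝ)) / jetT Δ a b c (xNode Δ a b c (fermiEnergyOf Δ a b c (21 / 50 : ℝ))) (fermiEnergyOf Δ a b c (21 / 50 : ℝ)) ∈ Icc (91 / 1250 : ℝ) (2963 / 10000 : ℝ) := by
  rcases mem_Icc_split hΔ (371 / 200 : ℝ) with hΔ | hΔ
  · rcases mem_Icc_split hΔ (133 / 80 : ℝ) with hΔ | hΔ
    · rcases mem_Icc_split ha (51 / 40 : ℝ) with ha' | ha'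
      · exact (tl1223OPJet_0_0 hΔ ha' hb hc).widen (by norm_num [SC]) (by norm_num [SC]) (by norm_num [SC])
          (by norm_num [SC]) (by norm_num [SC]) (by norm_num [SC])
      · exact (tl1223OPJet_0_1 hΔ ha' hb hc).widen (by norm_num [SC]) (by norm_num [SC]) (by norm_num [SC])
          (by norm_num [SC]) (by norm_num [SC]) (by norm_num [SC])
    · rcases mem_Icc_split ha (51 / 40 : ℝ) with ha' | ha'
      · exact (tl1223OPJet_1_0 hΔ ha' hb hc).widen (by norm_num [SC]) (by norm_num [SC]) (by norm_num [SC])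
          (by norm_num [SC]) (by norm_num [SC]) (by norm_num [SC])
      · exact (tl1223OPJet_1_1 hΔ ha' hb hc).widen (by norm_num [SC]) (by norm_num [SC]) (by norm_num [SC])
          (by norm_num [SC]) (by norm_num [SC]) (by norm_num [SC])
  · rcases mem_Icc_split hΔ (819 / 400 : ℝ) with hΔ | hΔ
    · rcases mem_Icc_split ha (51 / 40 : ℝ) with ha' | ha'
      · exact (tl1223OPJet_2_0 hΔ ha' hb hc).widen (by norm_num [SC]) (by norm_num [SC]) (by norm_num [SC])
          (by norm_num [SC]) (by norm_num [SC]) (by norm_num [SC])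
      · exact (tl1223OPJet_2_1 hΔ ha' hb hc).widen (by norm_num [SC]) (by norm_num [SC]) (by norm_num [SC])
          (by norm_num [SC]) (by norm_num [SC]) (by norm_num [SC])
    · rcases mem_Icc_split ha (51 / 40 : ℝ) with ha' | ha'
      · exact (tl1223OPJet_3_0 hΔ ha' hb hc).widen (by norm_num [SC]) (by norm_num [SC]) (by norm_num [SC])
          (by norm_num [SC]) (by norm_num [SC]) (by norm_num [SC])
      · exact (tl1223OPJet_3_1 hΔ ha' hb hc).widen (by norm_num [SC]) (by norm_num [SC]) (by norm_num [SC])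
          (by norm_num [SC]) (by norm_num [SC]) (by norm_num [SC])

end Summit.Ventures.CertifiedManyBodySolver.Downfold.Emery
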